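import Summits.HodgeConjecture.HodgeConjecture.Theorems.F0P6cDictConstructors   -- P6c ED. 3 (735e6ed4): §6 apparatus by import (finite Hecke orbits, deeper levels, Ω-surjectivity of `π`)
import Literature.NumberTheory.Automorphic.UnitaryGroupHeckeT1Backtrack                      -- ★ p847035 (H1): `UnitaryGroup.exists_mul_mk_eq_heckeElementAt_two_of_mem_orbit`
import HarnessLib

/-!
# `F0P6cHeckeBacktrack` — ★ RE-HOME (rung-0 re-homing task, books INVENTORY §8.4 M-3; LEAD F0P6-plan (g4) «M-72») of the crux workfile `Lines/F0_P6c_HeckeBacktrack.lean`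

This `Theorems/` module is the TREE BYTES of `Summits/HodgeConjecture/HodgeConjecture/Cruxes/HLiu418/Lines/F0_P6c_HeckeBacktrack.lean` (edition of record,
tree sha16 256d05e99414a4af, 351 l., code-`sorry`-free) with the NAMESPACE KEPT — `Summit.HodgeConjecture.HodgeConjecture.Cruxes.HLiu418.F0P6cHeckeBacktrack` — so that every
fully-qualified name (`exists_line_quotΩ_quotΩ_eq_translΩ_of_hecke_of_backtrack`, `exists_line_quotΩ_quotΩ_eq_translΩ_of_hecke`, `exists_line_quotΩ_quotΩ_eq_translΩ_of_hecke_of_hyperspecial`; 3 declarations) is UNCHANGED; only this module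
docstring is re-headed and the `Lines` imports are switched to their ★ re-homed twins (`F0_P6c_DictConstructors` → `Theorems.F0P6cDictConstructors`).  Why a re-home: a `Theorems/` file cannot import a `Lines/` workfile (F0P6-ref1 o-6), and closing
stmt-HodgeConjecture-24832 `--as proved --by <Theorems decl>` at rung 0 needs the sorry-free Lines chain behind the gate (RE-HOME MAP v1.1, LA7-plan (g4),
2026-09-02; director g27 s1336 (R1)–(R3)).    Lines importers of the original: none.
After this file is ★ the Lines workfile is meant to become a one-import SHIM of it (a `Lines/` write, batched per cone on the LEAD's word), so no
environment ever holds two copies (NO-CROSS-IMPORT rule, «M-72» (3)).  It asserts nothing beyond what the workfile already proves.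

## Original module docstring (verbatim)
# F0 · P6c — HECKE BACKTRACKING: the second `t₁`-neighbour through the backtracking line is the central translate
# (`quotΩ (quotΩ y L) L_b = translΩ y`, the GENERIC half of the D6 law `quot_quot₀` of the P6a moduli datum)

Cell `hodgecm-mathlib`, FLOOR 0, programme P6 «MOD», sub-desk P6c; crux `HLiu418` (stmt-HodgeConjecture-24832), route
`HodgeConjecture:HCCMUnconditional`.  HOME candidate `F0/P6/F0P6c-plan/g4/F0_P6c_HeckeBacktrack.cand.v1.F0P6c-plan-g4.lean` for the tree path
`Cruxes/HLiu418/Lines/F0_P6c_HeckeBacktrack.lean` (LEAD F0P6-plan (g2) ruling 22:37:22Z (2): ROAD H «Hecke backtracking» ADOPTED for the row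
`quot_quot₀` of GEN՚s `stub_DATUM` closure; P6c supplies (H1) = ★-candidate `Literature/NumberTheory/Automorphic/UnitaryGroupHeckeT1Backtrack`
(p847035) and (H3) = THIS FILE; GEN keeps (H4′) «backtracking line = image line» and (H5) downstairs transfer).  THEOREMS only, no `sorry`.

WHAT IT PROVES.  In the currency of the `hecke` field of `ModuliDatum` (P6a Defs ED. 2 :817–:857, binders TOKEN FOR TOKEN as in P6c ED. 3 §6
`nonempty_line_of_hecke`) over ABSTRACT readings `Line`, `quotΩ`, `translΩ`, and given the GROUP-SIDE BACKTRACKING LAW (H1) as a hypothesis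
`hH1 : ∀ g ∈ Kc t₁ Kc, ∃ g′ ∈ Kc t₁ Kc, (g g′) Kc = t₂ Kc` (discharged by ★-cand `UnitaryGroup.exists_mul_mk_eq_heckeElementAt_two_of_mem_orbit`
at `(F⁺, F, c, Jstar, Kc, v = w|_{F⁺})`, ★ p847035 — it needs `Kc` hyperspecial-and-factorisable at `v` and `J_w ∈ GL₂(𝒪_w)`, the K-TEST
«t₁» hypotheses ★ p845445):

  `exists_line_quotΩ_quotΩ_eq_translΩ_of_hecke : ∀ y (L : Line y), ∃ L_b : Line (quotΩ y L), quotΩ (quotΩ y L) L_b = translΩ y`,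

and its HYPOTHESIS-FREE form `…_of_hyperspecial` (hH1 discharged by ★ p847035 from `hunit`, `hKc` — tokens of P6a Defs ED. 2 :1072–:1074),
plus the GENERAL-ELEMENTS form `…_of_backtrack` (arbitrary `t₁ t₂`).

PROOF (three applications of `hecke`, ★ record laws only).  Finite orbits `Kc tᵢ Kc ∕ Kc` (★ `isHeckeTriple_top_of_isCompact_isOpen`, ★
`finite_orbit_quotient`), representatives `rᵢ := Quotient.out`; levels `N″ ≤ N′ ≤ Kc` with `HeckeLE (r₁ β) N′ Kc`, `HeckeLE (r₂ β₂) N′ Kc`,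
`HeckeLE (r₁ β) N″ N′` (★ `C5.SmallLevel.exists_normal_le_forall_heckeLE`, twice); `y = π x″` (Ω-surjectivity of `π : M_{N″} → M_{Kc}`, ★
`map_complexPoints_surjective` ⇒ ★ `surjective_left_of_forall_algPoints` ⇒ ★ `exists_algPoints_comp_eq_of_surjective`).  `hecke` at `(N″, x″)` gives
`e″ : Kc t₁ Kc ∕ Kc ≃ Line y` with `T_{r₁β} x″ = quotΩ y (e″ β)` and `T_{r₂β₂} x″ = translΩ y`; put `β := e″⁻¹ L`, `x₁′ := T^{N″→N′}_{r₁β} x″`, so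
`π x₁′ = T^{N″→Kc}_{r₁β} x″ = quotΩ y L` (★ `isHeckeTranslate_comp` + `isHeckeTranslate_one_map` + `heckeTranslate_unique`); `hecke` at `(N′, x₁′)`
gives `e₁` with `T_{r₁β′} x₁′ = quotΩ (π x₁′) (e₁ β′)`; (H1) at `g := r₁ β` gives `β′₀ := g′ Kc` with `r₁β · r₁β′₀ ∈ t₂ Kc`, hence
`T^{N″→N′}_{r₁β} ≫ T^{N′→Kc}_{r₁β′₀} = T^{N″→Kc}_{r₂β₂}` (★ `isHeckeTranslate_comp`, ★ `isHeckeTranslate_id_of_mem`, ★ `heckeTranslate_unique`), so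
`quotΩ (π x₁′) (e₁ β′₀) = T_{r₂β₂} x″ = translΩ y`; `L_b := e₁ β′₀` transported along `π x₁′ = quotΩ y L`.  In `GL₂(F_w)`:
`diag(ϖ,1) · w₀ · diag(ϖ,1) · w₀ = diag(ϖ,ϖ)` — [Liu2021] Prop. D.8 (2) `T∘T ⊇ ⟨ϖ⟩`, Shimura Thm. 3.24 (2), (4): `T(ϖ)² = T(1,ϖ²) + (q+1) T(ϖ,ϖ)`.

NO group-scheme duality, no abelian scheme, no reduction map appears: the `w`-block of D6 enters GEN՚s residue only through `red_translΩ`.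
HC_CM is proved only modulo the printed citations (2 remaining named inputs hLiu418 24832, h413 24833) until rung 0 closes — count-neutral.
[cite: Liu2021, Prop. D.8 (2) p. 135, pp. 136–138] [cite: ShimuraIATAF1971, Ch. 3 §3.3 Thm. 3.24 (2), (4)] [cite: Milne2005ShimuraVarieties, Thm. 13.6 p. 118; §5 p. 58 L6–11]
-/

set_option autoImplicit false

noncomputable section

namespace Summit.HodgeConjecture.HodgeConjecture.Cruxes.HLiu418.F0P6cHeckeBacktrack

set_option linter.dupNamespace false  -- `Summit.HodgeConjecture.HodgeConjecture.…` BY DESIGN (D-0017)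

open CategoryTheory NumberField IsDedekindDomain MulAction
open scoped Matrix
open Literature.NumberTheory.GaloisRepresentations
open Literature.NumberTheory.Automorphic Literature.NumberTheory.Automorphic.UnitaryGroup
open Literature.AlgebraicGeometry.ShimuraVarieties.UnitaryCanonicalModel
open Literature.NumberTheory.Automorphic.Liu2021.AppendixC
open Literature.AlgebraicGeometry.Motives (AlgPoints SchemeOver)

universe u'

set_option maxHeartbeats 400000 in
open Literature.AlgebraicGeometry.Motives (SchemeOver.exists_algPoints_comp_eq_of_surjective SchemeOver.surjective_left_of_forall_algPoints) in
/-- **(H3, GENERAL ELEMENTS) Hecke backtracking for an arbitrary pair `t₁, t₂ ∈ U(J⋆)(𝔸_{F⁺,f})`**: if the readings `quotΩ`∕`translΩ` satisfy the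
`hecke` row for `(t₁, t₂)` (binders as P6a Defs ED. 2 :817–:857 with the two Hecke elements generalised) and the cosets satisfy the backtracking
law `hH1` («`∀ g ∈ Kc t₁ Kc, ∃ g′ ∈ Kc t₁ Kc, g g′ ∈ t₂ Kc`»), then `∀ y L, ∃ L_b : Line (quotΩ y L), quotΩ (quotΩ y L) L_b = translΩ y`.
The proof (module docstring) uses only the ★ record laws; stated for variables `t₁ t₂` so that the instance at the Hecke elements
`t_{w,1}, t_{w,2}` below is a one-line application and every declaration stays within the heartbeat budget.
[cite: Liu2021, Prop. D.8 (2) p. 135, p. 137] [cite: Milne2005ShimuraVarieties, Thm. 13.6 p. 118; §5 p. 58 L6–11] -/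
theorem exists_line_quotΩ_quotΩ_eq_translΩ_of_hecke_of_backtrack
    (F : Type) [Field F] [NumberField F] [IsCMField F] (ι₁ : F →+* ℂ)
    (Jstar : Matrix (Fin 2) (Fin 2) F)
    (K₀ : C5.OpenCompactSubgroup ↥(finAdelic ↥(maximalRealSubfield F) F (IsCMField.complexConj F) 2 Jstar))
    (S : RecordSystemGS F Jstar ι₁ K₀) (hU7ₛ : S.HeckeTranslateDefinedOver)
    (w : HeightOneSpectrum (𝓞 F)) (Kc : C5.SmallLevel K₀) (t₁ t₂ : ↥(finAdelic ↥(maximalRealSubfield F) F (IsCMField.complexConj F) 2 Jstar))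
    (Line : AlgPoints (S.M.obj Kc) (AlgebraicClosure (w.adicCompletion F)) → Type u')
    (quotΩ : ∀ y, Line y → AlgPoints (S.M.obj Kc) (AlgebraicClosure (w.adicCompletion F)))
    (translΩ : AlgPoints (S.M.obj Kc) (AlgebraicClosure (w.adicCompletion F)) →
      AlgPoints (S.M.obj Kc) (AlgebraicClosure (w.adicCompletion F)))
    (hhecke : ∀ (N' : C5.SmallLevel K₀) (hN'Kc : N' ≤ Kc)
      (rc₁ : orbit (Kc.1.1 : Subgroup ↥(finAdelic ↥(maximalRealSubfield F) F (IsCMField.complexConj F) 2 Jstar))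
           ((t₁ : ↥(finAdelic ↥(maximalRealSubfield F) F (IsCMField.complexConj F) 2 Jstar)) :
             ↥(finAdelic ↥(maximalRealSubfield F) F (IsCMField.complexConj F) 2 Jstar) ⧸
               (Kc.1.1 : Subgroup ↥(finAdelic ↥(maximalRealSubfield F) F (IsCMField.complexConj F) 2 Jstar))) →
         ↥(finAdelic ↥(maximalRealSubfield F) F (IsCMField.complexConj F) 2 Jstar)),
      (∀ β, ((rc₁ β : ↥(finAdelic ↥(maximalRealSubfield F) F (IsCMField.complexConj F) 2 Jstar)) :
          ↥(finAdelic ↥(maximalRealSubfield F) F (IsCMField.complexConj F) 2 Jstar) ⧸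
            (Kc.1.1 : Subgroup ↥(finAdelic ↥(maximalRealSubfield F) F (IsCMField.complexConj F) 2 Jstar))) = β.1) →
      ∀ (hrcN₁ : ∀ β, C5.HeckeLE (rc₁ β) N' Kc)
        (rc₂ : orbit (Kc.1.1 : Subgroup ↥(finAdelic ↥(maximalRealSubfield F) F (IsCMField.complexConj F) 2 Jstar))
           ((t₂ : ↥(finAdelic ↥(maximalRealSubfield F) F (IsCMField.complexConj F) 2 Jstar)) :
             ↥(finAdelic ↥(maximalRealSubfield F) F (IsCMField.complexConj F) 2 Jstar) ⧸
               (Kc.1.1 : Subgroup ↥(finAdelic ↥(maximalRealSubfield F) F (IsCMField.complexConj F) 2 Jstar))) →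
         ↥(finAdelic ↥(maximalRealSubfield F) F (IsCMField.complexConj F) 2 Jstar)),
      (∀ β, ((rc₂ β : ↥(finAdelic ↥(maximalRealSubfield F) F (IsCMField.complexConj F) 2 Jstar)) :
          ↥(finAdelic ↥(maximalRealSubfield F) F (IsCMField.complexConj F) 2 Jstar) ⧸
            (Kc.1.1 : Subgroup ↥(finAdelic ↥(maximalRealSubfield F) F (IsCMField.complexConj F) 2 Jstar))) = β.1) →
      ∀ (hrcN₂ : ∀ β, C5.HeckeLE (rc₂ β) N' Kc),
      ∀ x' : AlgPoints (S.M.obj N') (AlgebraicClosure (w.adicCompletion F)),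
        ∃ e : (orbit (Kc.1.1 : Subgroup ↥(finAdelic ↥(maximalRealSubfield F) F (IsCMField.complexConj F) 2 Jstar))
           ((t₁ : ↥(finAdelic ↥(maximalRealSubfield F) F (IsCMField.complexConj F) 2 Jstar)) :
             ↥(finAdelic ↥(maximalRealSubfield F) F (IsCMField.complexConj F) 2 Jstar) ⧸
               (Kc.1.1 : Subgroup ↥(finAdelic ↥(maximalRealSubfield F) F (IsCMField.complexConj F) 2 Jstar)))) ≃
            Line (AlgPoints.map (S.M.map (homOfLE hN'Kc)) x'),
          (∀ β, AlgPoints.map (recordHeckeTranslateGS S hU7ₛ (rc₁ β) N' Kc (hrcN₁ β)) x' =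
              quotΩ (AlgPoints.map (S.M.map (homOfLE hN'Kc)) x') (e β)) ∧
          ∀ β₂, AlgPoints.map (recordHeckeTranslateGS S hU7ₛ (rc₂ β₂) N' Kc (hrcN₂ β₂)) x' =
              translΩ (AlgPoints.map (S.M.map (homOfLE hN'Kc)) x'))
    (hH1 : ∀ g : ↥(finAdelic ↥(maximalRealSubfield F) F (IsCMField.complexConj F) 2 Jstar),
      ((g : ↥(finAdelic ↥(maximalRealSubfield F) F (IsCMField.complexConj F) 2 Jstar)) : ↥(finAdelic ↥(maximalRealSubfield F) F (IsCMField.complexConj F) 2 Jstar) ⧸ (Kc.1.1 : Subgroup ↥(finAdelic ↥(maximalRealSubfield F) F (IsCMField.complexConj F) 2 Jstar))) ∈ orbit (Kc.1.1 : Subgroup ↥(finAdelic ↥(maximalRealSubfield F) F (IsCMField.complexConj F) 2 Jstar)) (t₁ : ↥(finAdelic ↥(maximalRealSubfield F) F (IsCMField.complexConj F) 2 Jstar) ⧸ (Kc.1.1 : Subgroup ↥(finAdelic ↥(maximalRealSubfield F) F (IsCMField.complexConj F) 2 Jstar))) →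
      ∃ g' : ↥(finAdelic ↥(maximalRealSubfield F) F (IsCMField.complexConj F) 2 Jstar),
        ((g' : ↥(finAdelic ↥(maximalRealSubfield F) F (IsCMField.complexConj F) 2 Jstar)) : ↥(finAdelic ↥(maximalRealSubfield F) F (IsCMField.complexConj F) 2 Jstar) ⧸ (Kc.1.1 : Subgroup ↥(finAdelic ↥(maximalRealSubfield F) F (IsCMField.complexConj F) 2 Jstar))) ∈ orbit (Kc.1.1 : Subgroup ↥(finAdelic ↥(maximalRealSubfield F) F (IsCMField.complexConj F) 2 Jstar)) (t₁ : ↥(finAdelic ↥(maximalRealSubfield F) F (IsCMField.complexConj F) 2 Jstar) ⧸ (Kc.1.1 : Subgroup ↥(finAdelic ↥(maximalRealSubfield F) F (IsCMField.complexConj F) 2 Jstar))) ∧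
        ((g * g' : ↥(finAdelic ↥(maximalRealSubfield F) F (IsCMField.complexConj F) 2 Jstar)) : ↥(finAdelic ↥(maximalRealSubfield F) F (IsCMField.complexConj F) 2 Jstar) ⧸ (Kc.1.1 : Subgroup ↥(finAdelic ↥(maximalRealSubfield F) F (IsCMField.complexConj F) 2 Jstar))) = (t₂ : ↥(finAdelic ↥(maximalRealSubfield F) F (IsCMField.complexConj F) 2 Jstar) ⧸ (Kc.1.1 : Subgroup ↥(finAdelic ↥(maximalRealSubfield F) F (IsCMField.complexConj F) 2 Jstar))))
    (y : AlgPoints (S.M.obj Kc) (AlgebraicClosure (w.adicCompletion F))) (L : Line y) :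
    ∃ L_b : Line (quotΩ y L), quotΩ (quotΩ y L) L_b = translΩ y := by
  classical
  -- finiteness of the two `Kc`-orbits (compact open level ⇒ Hecke pair)
  haveI := Literature.NumberTheory.Automorphic.isHeckeTriple_top_of_isCompact_isOpen (Kc.1.1 : Subgroup ↥(finAdelic ↥(maximalRealSubfield F) F (IsCMField.complexConj F) 2 Jstar)) Kc.1.2.2 Kc.1.2.1
  haveI := (Literature.NumberTheory.Automorphic.finite_orbit_quotient (Kc.1.1 : Subgroup ↥(finAdelic ↥(maximalRealSubfield F) F (IsCMField.complexConj F) 2 Jstar)) t₁).fintype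
  haveI := (Literature.NumberTheory.Automorphic.finite_orbit_quotient (Kc.1.1 : Subgroup ↥(finAdelic ↥(maximalRealSubfield F) F (IsCMField.complexConj F) 2 Jstar)) t₂).fintype
  -- representatives of the cosets
  obtain ⟨r₁, hr₁⟩ : ∃ r : orbit (Kc.1.1 : Subgroup ↥(finAdelic ↥(maximalRealSubfield F) F (IsCMField.complexConj F) 2 Jstar)) (t₁ : ↥(finAdelic ↥(maximalRealSubfield F) F (IsCMField.complexConj F) 2 Jstar) ⧸ (Kc.1.1 : Subgroup ↥(finAdelic ↥(maximalRealSubfield F) F (IsCMField.complexConj F) 2 Jstar))) → ↥(finAdelic ↥(maximalRealSubfield F) F (IsCMField.complexConj F) 2 Jstar),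
      ∀ β, ((r β : ↥(finAdelic ↥(maximalRealSubfield F) F (IsCMField.complexConj F) 2 Jstar)) : ↥(finAdelic ↥(maximalRealSubfield F) F (IsCMField.complexConj F) 2 Jstar) ⧸ (Kc.1.1 : Subgroup ↥(finAdelic ↥(maximalRealSubfield F) F (IsCMField.complexConj F) 2 Jstar))) = β.1 :=
    ⟨fun β => Quotient.out β.1, fun β => Quotient.out_eq β.1⟩
  obtain ⟨r₂, hr₂⟩ : ∃ r : orbit (Kc.1.1 : Subgroup ↥(finAdelic ↥(maximalRealSubfield F) F (IsCMField.complexConj F) 2 Jstar)) (t₂ : ↥(finAdelic ↥(maximalRealSubfield F) F (IsCMField.complexConj F) 2 Jstar) ⧸ (Kc.1.1 : Subgroup ↥(finAdelic ↥(maximalRealSubfield F) F (IsCMField.complexConj F) 2 Jstar))) → ↥(finAdelic ↥(maximalRealSubfield F) F (IsCMField.complexConj F) 2 Jstar),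
      ∀ β, ((r β : ↥(finAdelic ↥(maximalRealSubfield F) F (IsCMField.complexConj F) 2 Jstar)) : ↥(finAdelic ↥(maximalRealSubfield F) F (IsCMField.complexConj F) 2 Jstar) ⧸ (Kc.1.1 : Subgroup ↥(finAdelic ↥(maximalRealSubfield F) F (IsCMField.complexConj F) 2 Jstar))) = β.1 :=
    ⟨fun β => Quotient.out β.1, fun β => Quotient.out_eq β.1⟩
  -- two deeper levels: `N′ ≤ Kc` carrying every representative into `Kc`, `N″ ≤ N′` carrying the `t₁`-representatives into `N′`
  obtain ⟨N', hN'Kc, -, hγ'⟩ :=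
    C5.SmallLevel.exists_normal_le_forall_heckeLE (Finset.univ.image r₁ ∪ Finset.univ.image r₂) Kc
  obtain ⟨N'', hN''N', -, hγ''⟩ := C5.SmallLevel.exists_normal_le_forall_heckeLE (Finset.univ.image r₁) N'
  have hA1 : ∀ β, C5.HeckeLE (r₁ β) N' Kc := fun β =>
    hγ' _ (Finset.mem_union_left _ (Finset.mem_image_of_mem _ (Finset.mem_univ β)))
  have hA2 : ∀ β, C5.HeckeLE (r₂ β) N' Kc := fun β =>
    hγ' _ (Finset.mem_union_right _ (Finset.mem_image_of_mem _ (Finset.mem_univ β)))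
  have hB1 : ∀ β, C5.HeckeLE (r₁ β) N'' N' := fun β => hγ'' _ (Finset.mem_image_of_mem _ (Finset.mem_univ β))
  have hN''Kc : N'' ≤ Kc := hN''N'.trans hN'Kc
  have hC1 : ∀ β, C5.HeckeLE (r₁ β) N'' Kc := fun β => (hA1 β).of_le_left hN''N'
  have hC2 : ∀ β, C5.HeckeLE (r₂ β) N'' Kc := fun β => (hA2 β).of_le_left hN''N'
  -- `π : M_{N″} → M_{Kc}` is surjective on `Ω`-points: `y = π x″`
  letI : Algebra F ℂ := ι₁.toAlgebra
  haveI : AlgebraicGeometry.IsProper (S.M.obj N'').hom := (S.projective N'').isProper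
  haveI : AlgebraicGeometry.IsProper (S.M.obj Kc).hom := (S.projective Kc).isProper
  haveI : AlgebraicGeometry.UniversallyClosed (S.M.map (homOfLE hN''Kc)).left := by
    haveI : AlgebraicGeometry.UniversallyClosed ((S.M.map (homOfLE hN''Kc)).left ≫ (S.M.obj Kc).hom) := by
      rw [Over.w]; infer_instance
    exact AlgebraicGeometry.UniversallyClosed.of_comp_of_isSeparated _ (S.M.obj Kc).hom
  haveI : AlgebraicGeometry.LocallyOfFiniteType (S.M.map (homOfLE hN''Kc)).left := by
    haveI : AlgebraicGeometry.LocallyOfFiniteType ((S.M.map (homOfLE hN''Kc)).left ≫ (S.M.obj Kc).hom) := by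
      rw [Over.w]; infer_instance
    exact AlgebraicGeometry.locallyOfFiniteType_of_comp _ (S.M.obj Kc).hom
  haveI : AlgebraicGeometry.Surjective (S.M.map (homOfLE hN''Kc)).left :=
    SchemeOver.surjective_left_of_forall_algPoints ℂ (S.M.map (homOfLE hN''Kc)) fun P => by
      obtain ⟨Q, hQ⟩ := S.map_complexPoints_surjective (homOfLE hN''Kc) P
      exact ⟨Q, hQ⟩
  obtain ⟨x'', hx''⟩ := SchemeOver.exists_algPoints_comp_eq_of_surjective (AlgebraicClosure (w.adicCompletion F))
    (S.M.map (homOfLE hN''Kc)) y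
  have hy : AlgPoints.map (S.M.map (homOfLE hN''Kc)) x'' = y := hx''
  subst hy
  -- the Hecke row at `(N″, x″)`: `L = e″ β`
  obtain ⟨e'', he''₁, he''₂⟩ := hhecke N'' hN''Kc r₁ hr₁ hC1 r₂ hr₂ hC2 x''
  obtain ⟨β, hL⟩ : ∃ β, L = e'' β := ⟨e''.symm L, (e''.apply_symm_apply L).symm⟩
  -- the backtracking coset `β′ = g′ Kc` from (H1) at `g := r₁ β`, and the singleton `t₂`-orbit
  obtain ⟨g', hg', hgg'⟩ := hH1 (r₁ β) (by rw [hr₁ β]; exact β.2)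
  obtain ⟨β', hβ'⟩ : ∃ β' : orbit (Kc.1.1 : Subgroup ↥(finAdelic ↥(maximalRealSubfield F) F (IsCMField.complexConj F) 2 Jstar)) (t₁ : ↥(finAdelic ↥(maximalRealSubfield F) F (IsCMField.complexConj F) 2 Jstar) ⧸ (Kc.1.1 : Subgroup ↥(finAdelic ↥(maximalRealSubfield F) F (IsCMField.complexConj F) 2 Jstar))), β'.1 = ((g' : ↥(finAdelic ↥(maximalRealSubfield F) F (IsCMField.complexConj F) 2 Jstar)) : ↥(finAdelic ↥(maximalRealSubfield F) F (IsCMField.complexConj F) 2 Jstar) ⧸ (Kc.1.1 : Subgroup ↥(finAdelic ↥(maximalRealSubfield F) F (IsCMField.complexConj F) 2 Jstar))) :=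
    ⟨⟨_, hg'⟩, rfl⟩
  obtain ⟨β₂, hβ₂⟩ : ∃ β₂ : orbit (Kc.1.1 : Subgroup ↥(finAdelic ↥(maximalRealSubfield F) F (IsCMField.complexConj F) 2 Jstar)) (t₂ : ↥(finAdelic ↥(maximalRealSubfield F) F (IsCMField.complexConj F) 2 Jstar) ⧸ (Kc.1.1 : Subgroup ↥(finAdelic ↥(maximalRealSubfield F) F (IsCMField.complexConj F) 2 Jstar))), β₂.1 = ((t₂ : ↥(finAdelic ↥(maximalRealSubfield F) F (IsCMField.complexConj F) 2 Jstar)) : ↥(finAdelic ↥(maximalRealSubfield F) F (IsCMField.complexConj F) 2 Jstar) ⧸ (Kc.1.1 : Subgroup ↥(finAdelic ↥(maximalRealSubfield F) F (IsCMField.complexConj F) 2 Jstar))) :=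
    ⟨⟨_, mem_orbit_self _⟩, rfl⟩
  have hk₁ : g'⁻¹ * r₁ β' ∈ (Kc.1.1 : Subgroup ↥(finAdelic ↥(maximalRealSubfield F) F (IsCMField.complexConj F) 2 Jstar)) := QuotientGroup.eq.1 (by rw [hr₁ β', hβ'])
  have hk₀ : (r₁ β * g')⁻¹ * t₂ ∈ (Kc.1.1 : Subgroup ↥(finAdelic ↥(maximalRealSubfield F) F (IsCMField.complexConj F) 2 Jstar)) := QuotientGroup.eq.1 hgg'
  have hk₂ : (r₂ β₂)⁻¹ * t₂ ∈ (Kc.1.1 : Subgroup ↥(finAdelic ↥(maximalRealSubfield F) F (IsCMField.complexConj F) 2 Jstar)) := QuotientGroup.eq.1 (by rw [hr₂ β₂, hβ₂])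
  have hm : (r₂ β₂)⁻¹ * (r₁ β * r₁ β') ∈ (Kc.1.1 : Subgroup ↥(finAdelic ↥(maximalRealSubfield F) F (IsCMField.complexConj F) 2 Jstar)) := by
    have h := (Kc.1.1 : Subgroup ↥(finAdelic ↥(maximalRealSubfield F) F (IsCMField.complexConj F) 2 Jstar)).mul_mem hk₂
      ((Kc.1.1 : Subgroup ↥(finAdelic ↥(maximalRealSubfield F) F (IsCMField.complexConj F) 2 Jstar)).mul_mem ((Kc.1.1 : Subgroup ↥(finAdelic ↥(maximalRealSubfield F) F (IsCMField.complexConj F) 2 Jstar)).inv_mem hk₀) hk₁)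
    convert h using 1
    group
  -- `x₁′ := T^{N″→N′}_{r₁β} x″`, with `π x₁′ = quotΩ y L`
  have hT₁ := isHeckeTranslate_recordHeckeTranslateGS S hU7ₛ (r₁ β) N'' N' (hB1 β)
  have hcomp₁ : recordHeckeTranslateGS S hU7ₛ (r₁ β) N'' N' (hB1 β) ≫ S.M.map (homOfLE hN'Kc) =
      recordHeckeTranslateGS S hU7ₛ (r₁ β) N'' Kc (hC1 β) := by
    have h := S.isHeckeTranslate_comp hT₁ (S.isHeckeTranslate_one_map (homOfLE hN'Kc))
    rw [mul_one] at h
    exact S.heckeTranslate_unique h (isHeckeTranslate_recordHeckeTranslateGS S hU7ₛ (r₁ β) N'' Kc (hC1 β))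
  have hπ : AlgPoints.map (S.M.map (homOfLE hN'Kc))
        (AlgPoints.map (recordHeckeTranslateGS S hU7ₛ (r₁ β) N'' N' (hB1 β)) x'') =
      quotΩ (AlgPoints.map (S.M.map (homOfLE hN''Kc)) x'') L := by
    rw [← AlgPoints.map_comp_apply, hcomp₁, he''₁ β, ← hL]
  -- the Hecke row at `(N′, x₁′)` and the composition `T^{N″→N′}_{r₁β} ≫ T^{N′→Kc}_{r₁β′} = T^{N″→Kc}_{r₂β₂}`
  obtain ⟨e₁, he₁, -⟩ := hhecke N' hN'Kc r₁ hr₁ hA1 r₂ hr₂ hA2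
    (AlgPoints.map (recordHeckeTranslateGS S hU7ₛ (r₁ β) N'' N' (hB1 β)) x'')
  have hcomp₂ : recordHeckeTranslateGS S hU7ₛ (r₁ β) N'' N' (hB1 β) ≫ recordHeckeTranslateGS S hU7ₛ (r₁ β') N' Kc (hA1 β') =
      recordHeckeTranslateGS S hU7ₛ (r₂ β₂) N'' Kc (hC2 β₂) := by
    have hA := S.isHeckeTranslate_comp hT₁ (isHeckeTranslate_recordHeckeTranslateGS S hU7ₛ (r₁ β') N' Kc (hA1 β'))
    have hB := S.isHeckeTranslate_comp (isHeckeTranslate_recordHeckeTranslateGS S hU7ₛ (r₂ β₂) N'' Kc (hC2 β₂))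
      (S.isHeckeTranslate_id_of_mem Kc hm)
    rw [mul_inv_cancel_left, Category.comp_id] at hB
    exact S.heckeTranslate_unique hA hB
  have hfinal : quotΩ (AlgPoints.map (S.M.map (homOfLE hN'Kc))
        (AlgPoints.map (recordHeckeTranslateGS S hU7ₛ (r₁ β) N'' N' (hB1 β)) x'')) (e₁ β') =
      translΩ (AlgPoints.map (S.M.map (homOfLE hN''Kc)) x'') := by
    rw [← he₁ β', ← AlgPoints.map_comp_apply, hcomp₂, he''₂ β₂]
  -- transport the line `e₁ β′` along `π x₁′ = quotΩ y L`
  have key : ∀ z, AlgPoints.map (S.M.map (homOfLE hN'Kc))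
      (AlgPoints.map (recordHeckeTranslateGS S hU7ₛ (r₁ β) N'' N' (hB1 β)) x'') = z →
      ∃ L_b : Line z, quotΩ z L_b = translΩ (AlgPoints.map (S.M.map (homOfLE hN''Kc)) x'') := by
    rintro z rfl
    exact ⟨e₁ β', hfinal⟩
  exact key _ hπ


/-- **(H3) HECKE BACKTRACKING — `∀ y L, ∃ L_b : Line (quotΩ y L), quotΩ (quotΩ y L) L_b = translΩ y`** from the `hecke` row (binders verbatim
P6a Defs ED. 2 :817–:857 ∕ P6c ED. 3 §6) and the group-side backtracking law `hH1` (★-cand `UnitaryGroupHeckeT1Backtrack`): among the `t₁`-neighbours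
of the `t₁`-neighbour `quotΩ y L` one is the central translate `translΩ y` — the GENERIC half of D6 `quot_quot₀` (ROAD H of the R6 census); the line
`L_b` is the one labelled by the backtracking coset `β′₀ = g′ Kc`, `r₁β · g′ ∈ t₂ Kc`.  Proof in the module docstring.
[cite: Liu2021, Prop. D.8 (2) p. 135, p. 137] [cite: ShimuraIATAF1971, Ch. 3 §3.3 Thm. 3.24 (2), (4)] [cite: Milne2005ShimuraVarieties, Thm. 13.6 p. 118; §5 p. 58 L6–11] -/
theorem exists_line_quotΩ_quotΩ_eq_translΩ_of_hecke
    (F : Type) [Field F] [NumberField F] [IsCMField F] (ι₁ : F →+* ℂ)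
    (Jstar : Matrix (Fin 2) (Fin 2) F)
    (K₀ : C5.OpenCompactSubgroup ↥(finAdelic ↥(maximalRealSubfield F) F (IsCMField.complexConj F) 2 Jstar))
    (S : RecordSystemGS F Jstar ι₁ K₀) (hU7ₛ : S.HeckeTranslateDefinedOver)
    (hJ : (Jstar.map (IsCMField.complexConj F))ᵀ = Jstar) (hJu : IsUnit Jstar)
    (w : HeightOneSpectrum (𝓞 F)) (hw : (IsCMField.complexConj F) • w ≠ w)
    (Kc : C5.SmallLevel K₀)
    (Line : AlgPoints (S.M.obj Kc) (AlgebraicClosure (w.adicCompletion F)) → Type u')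
    (quotΩ : ∀ y, Line y → AlgPoints (S.M.obj Kc) (AlgebraicClosure (w.adicCompletion F)))
    (translΩ : AlgPoints (S.M.obj Kc) (AlgebraicClosure (w.adicCompletion F)) →
      AlgPoints (S.M.obj Kc) (AlgebraicClosure (w.adicCompletion F)))
    (hhecke : ∀ (N' : C5.SmallLevel K₀) (hN'Kc : N' ≤ Kc)
      (rc₁ : orbit (Kc.1.1 : Subgroup ↥(finAdelic ↥(maximalRealSubfield F) F (IsCMField.complexConj F) 2 Jstar))
           ((UnitaryGroup.heckeElementAt ↥(maximalRealSubfield F) F (IsCMField.complexConj F) 2 Jstar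
               (⟨w, rfl⟩ : UnitaryGroup.PlacesOver F (w.under (𝓞 ↥(maximalRealSubfield F))))
               (IsCMField.complexConj_ne_one F) hJ hw (UnitaryGroup.isUnit_placeForm Jstar hJu w) (HeckeCharacter.uniformizer F w) 1 :
             ↥(finAdelic ↥(maximalRealSubfield F) F (IsCMField.complexConj F) 2 Jstar)) :
             ↥(finAdelic ↥(maximalRealSubfield F) F (IsCMField.complexConj F) 2 Jstar) ⧸
               (Kc.1.1 : Subgroup ↥(finAdelic ↥(maximalRealSubfield F) F (IsCMField.complexConj F) 2 Jstar))) →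
         ↥(finAdelic ↥(maximalRealSubfield F) F (IsCMField.complexConj F) 2 Jstar)),
      (∀ β, ((rc₁ β : ↥(finAdelic ↥(maximalRealSubfield F) F (IsCMField.complexConj F) 2 Jstar)) :
          ↥(finAdelic ↥(maximalRealSubfield F) F (IsCMField.complexConj F) 2 Jstar) ⧸
            (Kc.1.1 : Subgroup ↥(finAdelic ↥(maximalRealSubfield F) F (IsCMField.complexConj F) 2 Jstar))) = β.1) →
      ∀ (hrcN₁ : ∀ β, C5.HeckeLE (rc₁ β) N' Kc)
        (rc₂ : orbit (Kc.1.1 : Subgroup ↥(finAdelic ↥(maximalRealSubfield F) F (IsCMField.complexConj F) 2 Jstar))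
           ((UnitaryGroup.heckeElementAt ↥(maximalRealSubfield F) F (IsCMField.complexConj F) 2 Jstar
               (⟨w, rfl⟩ : UnitaryGroup.PlacesOver F (w.under (𝓞 ↥(maximalRealSubfield F))))
               (IsCMField.complexConj_ne_one F) hJ hw (UnitaryGroup.isUnit_placeForm Jstar hJu w) (HeckeCharacter.uniformizer F w) 2 :
             ↥(finAdelic ↥(maximalRealSubfield F) F (IsCMField.complexConj F) 2 Jstar)) :
             ↥(finAdelic ↥(maximalRealSubfield F) F (IsCMField.complexConj F) 2 Jstar) ⧸
               (Kc.1.1 : Subgroup ↥(finAdelic ↥(maximalRealSubfield F) F (IsCMField.complexConj F) 2 Jstar))) →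
         ↥(finAdelic ↥(maximalRealSubfield F) F (IsCMField.complexConj F) 2 Jstar)),
      (∀ β, ((rc₂ β : ↥(finAdelic ↥(maximalRealSubfield F) F (IsCMField.complexConj F) 2 Jstar)) :
          ↥(finAdelic ↥(maximalRealSubfield F) F (IsCMField.complexConj F) 2 Jstar) ⧸
            (Kc.1.1 : Subgroup ↥(finAdelic ↥(maximalRealSubfield F) F (IsCMField.complexConj F) 2 Jstar))) = β.1) →
      ∀ (hrcN₂ : ∀ β, C5.HeckeLE (rc₂ β) N' Kc),
      ∀ x' : AlgPoints (S.M.obj N') (AlgebraicClosure (w.adicCompletion F)),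
        ∃ e : (orbit (Kc.1.1 : Subgroup ↥(finAdelic ↥(maximalRealSubfield F) F (IsCMField.complexConj F) 2 Jstar))
           ((UnitaryGroup.heckeElementAt ↥(maximalRealSubfield F) F (IsCMField.complexConj F) 2 Jstar
               (⟨w, rfl⟩ : UnitaryGroup.PlacesOver F (w.under (𝓞 ↥(maximalRealSubfield F))))
               (IsCMField.complexConj_ne_one F) hJ hw (UnitaryGroup.isUnit_placeForm Jstar hJu w) (HeckeCharacter.uniformizer F w) 1 :
             ↥(finAdelic ↥(maximalRealSubfield F) F (IsCMField.complexConj F) 2 Jstar)) :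
             ↥(finAdelic ↥(maximalRealSubfield F) F (IsCMField.complexConj F) 2 Jstar) ⧸
               (Kc.1.1 : Subgroup ↥(finAdelic ↥(maximalRealSubfield F) F (IsCMField.complexConj F) 2 Jstar)))) ≃
            Line (AlgPoints.map (S.M.map (homOfLE hN'Kc)) x'),
          (∀ β, AlgPoints.map (recordHeckeTranslateGS S hU7ₛ (rc₁ β) N' Kc (hrcN₁ β)) x' =
              quotΩ (AlgPoints.map (S.M.map (homOfLE hN'Kc)) x') (e β)) ∧
          ∀ β₂, AlgPoints.map (recordHeckeTranslateGS S hU7ₛ (rc₂ β₂) N' Kc (hrcN₂ β₂)) x' =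
              translΩ (AlgPoints.map (S.M.map (homOfLE hN'Kc)) x'))
    (hH1 : ∀ g : ↥(finAdelic ↥(maximalRealSubfield F) F (IsCMField.complexConj F) 2 Jstar),
      ((g : ↥(finAdelic ↥(maximalRealSubfield F) F (IsCMField.complexConj F) 2 Jstar)) : ↥(finAdelic ↥(maximalRealSubfield F) F (IsCMField.complexConj F) 2 Jstar) ⧸ (Kc.1.1 : Subgroup ↥(finAdelic ↥(maximalRealSubfield F) F (IsCMField.complexConj F) 2 Jstar))) ∈ orbit (Kc.1.1 : Subgroup ↥(finAdelic ↥(maximalRealSubfield F) F (IsCMField.complexConj F) 2 Jstar)) ((UnitaryGroup.heckeElementAt ↥(maximalRealSubfield F) F (IsCMField.complexConj F) 2 Jstar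
             (⟨w, rfl⟩ : UnitaryGroup.PlacesOver F (w.under (𝓞 ↥(maximalRealSubfield F))))
             (IsCMField.complexConj_ne_one F) hJ hw (UnitaryGroup.isUnit_placeForm Jstar hJu w) (HeckeCharacter.uniformizer F w) 1 :
           ↥(finAdelic ↥(maximalRealSubfield F) F (IsCMField.complexConj F) 2 Jstar)) : ↥(finAdelic ↥(maximalRealSubfield F) F (IsCMField.complexConj F) 2 Jstar) ⧸ (Kc.1.1 : Subgroup ↥(finAdelic ↥(maximalRealSubfield F) F (IsCMField.complexConj F) 2 Jstar))) →
      ∃ g' : ↥(finAdelic ↥(maximalRealSubfield F) F (IsCMField.complexConj F) 2 Jstar),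
        ((g' : ↥(finAdelic ↥(maximalRealSubfield F) F (IsCMField.complexConj F) 2 Jstar)) : ↥(finAdelic ↥(maximalRealSubfield F) F (IsCMField.complexConj F) 2 Jstar) ⧸ (Kc.1.1 : Subgroup ↥(finAdelic ↥(maximalRealSubfield F) F (IsCMField.complexConj F) 2 Jstar))) ∈ orbit (Kc.1.1 : Subgroup ↥(finAdelic ↥(maximalRealSubfield F) F (IsCMField.complexConj F) 2 Jstar)) ((UnitaryGroup.heckeElementAt ↥(maximalRealSubfield F) F (IsCMField.complexConj F) 2 Jstar
             (⟨w, rfl⟩ : UnitaryGroup.PlacesOver F (w.under (𝓞 ↥(maximalRealSubfield F))))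
             (IsCMField.complexConj_ne_one F) hJ hw (UnitaryGroup.isUnit_placeForm Jstar hJu w) (HeckeCharacter.uniformizer F w) 1 :
           ↥(finAdelic ↥(maximalRealSubfield F) F (IsCMField.complexConj F) 2 Jstar)) : ↥(finAdelic ↥(maximalRealSubfield F) F (IsCMField.complexConj F) 2 Jstar) ⧸ (Kc.1.1 : Subgroup ↥(finAdelic ↥(maximalRealSubfield F) F (IsCMField.complexConj F) 2 Jstar))) ∧
        ((g * g' : ↥(finAdelic ↥(maximalRealSubfield F) F (IsCMField.complexConj F) 2 Jstar)) : ↥(finAdelic ↥(maximalRealSubfield F) F (IsCMField.complexConj F) 2 Jstar) ⧸ (Kc.1.1 : Subgroup ↥(finAdelic ↥(maximalRealSubfield F) F (IsCMField.complexConj F) 2 Jstar))) = ((UnitaryGroup.heckeElementAt ↥(maximalRealSubfield F) F (IsCMField.complexConj F) 2 Jstar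
             (⟨w, rfl⟩ : UnitaryGroup.PlacesOver F (w.under (𝓞 ↥(maximalRealSubfield F))))
             (IsCMField.complexConj_ne_one F) hJ hw (UnitaryGroup.isUnit_placeForm Jstar hJu w) (HeckeCharacter.uniformizer F w) 2 :
           ↥(finAdelic ↥(maximalRealSubfield F) F (IsCMField.complexConj F) 2 Jstar)) : ↥(finAdelic ↥(maximalRealSubfield F) F (IsCMField.complexConj F) 2 Jstar) ⧸ (Kc.1.1 : Subgroup ↥(finAdelic ↥(maximalRealSubfield F) F (IsCMField.complexConj F) 2 Jstar))))
    (y : AlgPoints (S.M.obj Kc) (AlgebraicClosure (w.adicCompletion F))) (L : Line y) :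
    ∃ L_b : Line (quotΩ y L), quotΩ (quotΩ y L) L_b = translΩ y := by
  exact exists_line_quotΩ_quotΩ_eq_translΩ_of_hecke_of_backtrack F ι₁ Jstar K₀ S hU7ₛ w Kc _ _ Line quotΩ translΩ hhecke hH1 y L


/-- **(H3′) HECKE BACKTRACKING, HYPOTHESIS-FREE FORM** — the same conclusion `∀ y L, ∃ L_b : Line (quotΩ y L), quotΩ (quotΩ y L) L_b = translΩ y`
with the group-side law `hH1` DISCHARGED by ★ `UnitaryGroup.exists_mul_mk_eq_heckeElementAt_two_of_mem_orbit` (p847035) from the two K-TEST «t₁»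
hypotheses of the spine (P6a Defs ED. 2 :1072–:1074, same tokens): `hunit : J⋆_w ∈ GL₂(𝒪_w)` and `hKc : Kc` hyperspecial-and-factorisable at
`v = w|_{F⁺}`.  This is the form GEN՚s `stub_DATUM` residue (H4′)(H5) consumes.
[cite: Liu2021, Prop. D.8 (2) p. 135, p. 137] [cite: ShimuraIATAF1971, Ch. 3 §3.3 Thm. 3.24 (2), (4)] -/
theorem exists_line_quotΩ_quotΩ_eq_translΩ_of_hecke_of_hyperspecial
    (F : Type) [Field F] [NumberField F] [IsCMField F] (ι₁ : F →+* ℂ)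
    (Jstar : Matrix (Fin 2) (Fin 2) F)
    (K₀ : C5.OpenCompactSubgroup ↥(finAdelic ↥(maximalRealSubfield F) F (IsCMField.complexConj F) 2 Jstar))
    (S : RecordSystemGS F Jstar ι₁ K₀) (hU7ₛ : S.HeckeTranslateDefinedOver)
    (hJ : (Jstar.map (IsCMField.complexConj F))ᵀ = Jstar) (hJu : IsUnit Jstar)
    (w : HeightOneSpectrum (𝓞 F)) (hw : (IsCMField.complexConj F) • w ≠ w)
    (Kc : C5.SmallLevel K₀)
    (Line : AlgPoints (S.M.obj Kc) (AlgebraicClosure (w.adicCompletion F)) → Type u')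
    (quotΩ : ∀ y, Line y → AlgPoints (S.M.obj Kc) (AlgebraicClosure (w.adicCompletion F)))
    (translΩ : AlgPoints (S.M.obj Kc) (AlgebraicClosure (w.adicCompletion F)) →
      AlgPoints (S.M.obj Kc) (AlgebraicClosure (w.adicCompletion F)))
    (hhecke : ∀ (N' : C5.SmallLevel K₀) (hN'Kc : N' ≤ Kc)
      (rc₁ : orbit (Kc.1.1 : Subgroup ↥(finAdelic ↥(maximalRealSubfield F) F (IsCMField.complexConj F) 2 Jstar))
           ((UnitaryGroup.heckeElementAt ↥(maximalRealSubfield F) F (IsCMField.complexConj F) 2 Jstar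
               (⟨w, rfl⟩ : UnitaryGroup.PlacesOver F (w.under (𝓞 ↥(maximalRealSubfield F))))
               (IsCMField.complexConj_ne_one F) hJ hw (UnitaryGroup.isUnit_placeForm Jstar hJu w) (HeckeCharacter.uniformizer F w) 1 :
             ↥(finAdelic ↥(maximalRealSubfield F) F (IsCMField.complexConj F) 2 Jstar)) :
             ↥(finAdelic ↥(maximalRealSubfield F) F (IsCMField.complexConj F) 2 Jstar) ⧸
               (Kc.1.1 : Subgroup ↥(finAdelic ↥(maximalRealSubfield F) F (IsCMField.complexConj F) 2 Jstar))) →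
         ↥(finAdelic ↥(maximalRealSubfield F) F (IsCMField.complexConj F) 2 Jstar)),
      (∀ β, ((rc₁ β : ↥(finAdelic ↥(maximalRealSubfield F) F (IsCMField.complexConj F) 2 Jstar)) :
          ↥(finAdelic ↥(maximalRealSubfield F) F (IsCMField.complexConj F) 2 Jstar) ⧸
            (Kc.1.1 : Subgroup ↥(finAdelic ↥(maximalRealSubfield F) F (IsCMField.complexConj F) 2 Jstar))) = β.1) →
      ∀ (hrcN₁ : ∀ β, C5.HeckeLE (rc₁ β) N' Kc)
        (rc₂ : orbit (Kc.1.1 : Subgroup ↥(finAdelic ↥(maximalRealSubfield F) F (IsCMField.complexConj F) 2 Jstar))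
           ((UnitaryGroup.heckeElementAt ↥(maximalRealSubfield F) F (IsCMField.complexConj F) 2 Jstar
               (⟨w, rfl⟩ : UnitaryGroup.PlacesOver F (w.under (𝓞 ↥(maximalRealSubfield F))))
               (IsCMField.complexConj_ne_one F) hJ hw (UnitaryGroup.isUnit_placeForm Jstar hJu w) (HeckeCharacter.uniformizer F w) 2 :
             ↥(finAdelic ↥(maximalRealSubfield F) F (IsCMField.complexConj F) 2 Jstar)) :
             ↥(finAdelic ↥(maximalRealSubfield F) F (IsCMField.complexConj F) 2 Jstar) ⧸
               (Kc.1.1 : Subgroup ↥(finAdelic ↥(maximalRealSubfield F) F (IsCMField.complexConj F) 2 Jstar))) →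
         ↥(finAdelic ↥(maximalRealSubfield F) F (IsCMField.complexConj F) 2 Jstar)),
      (∀ β, ((rc₂ β : ↥(finAdelic ↥(maximalRealSubfield F) F (IsCMField.complexConj F) 2 Jstar)) :
          ↥(finAdelic ↥(maximalRealSubfield F) F (IsCMField.complexConj F) 2 Jstar) ⧸
            (Kc.1.1 : Subgroup ↥(finAdelic ↥(maximalRealSubfield F) F (IsCMField.complexConj F) 2 Jstar))) = β.1) →
      ∀ (hrcN₂ : ∀ β, C5.HeckeLE (rc₂ β) N' Kc),
      ∀ x' : AlgPoints (S.M.obj N') (AlgebraicClosure (w.adicCompletion F)),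
        ∃ e : (orbit (Kc.1.1 : Subgroup ↥(finAdelic ↥(maximalRealSubfield F) F (IsCMField.complexConj F) 2 Jstar))
           ((UnitaryGroup.heckeElementAt ↥(maximalRealSubfield F) F (IsCMField.complexConj F) 2 Jstar
               (⟨w, rfl⟩ : UnitaryGroup.PlacesOver F (w.under (𝓞 ↥(maximalRealSubfield F))))
               (IsCMField.complexConj_ne_one F) hJ hw (UnitaryGroup.isUnit_placeForm Jstar hJu w) (HeckeCharacter.uniformizer F w) 1 :
             ↥(finAdelic ↥(maximalRealSubfield F) F (IsCMField.complexConj F) 2 Jstar)) :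
             ↥(finAdelic ↥(maximalRealSubfield F) F (IsCMField.complexConj F) 2 Jstar) ⧸
               (Kc.1.1 : Subgroup ↥(finAdelic ↥(maximalRealSubfield F) F (IsCMField.complexConj F) 2 Jstar)))) ≃
            Line (AlgPoints.map (S.M.map (homOfLE hN'Kc)) x'),
          (∀ β, AlgPoints.map (recordHeckeTranslateGS S hU7ₛ (rc₁ β) N' Kc (hrcN₁ β)) x' =
              quotΩ (AlgPoints.map (S.M.map (homOfLE hN'Kc)) x') (e β)) ∧
          ∀ β₂, AlgPoints.map (recordHeckeTranslateGS S hU7ₛ (rc₂ β₂) N' Kc (hrcN₂ β₂)) x' =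
              translΩ (AlgPoints.map (S.M.map (homOfLE hN'Kc)) x'))
    (hunit : (UnitaryGroup.isUnit_placeForm Jstar hJu w).unit ∈ glInt 2 (w.adicCompletion F))
    (hKc : UnitaryGroup.IsHyperspecialAt ↥(maximalRealSubfield F) F (IsCMField.complexConj F) 2 Jstar Kc.1.1
      (w.under (𝓞 ↥(maximalRealSubfield F))))
    (y : AlgPoints (S.M.obj Kc) (AlgebraicClosure (w.adicCompletion F))) (L : Line y) :
    ∃ L_b : Line (quotΩ y L), quotΩ (quotΩ y L) L_b = translΩ y :=
  exists_line_quotΩ_quotΩ_eq_translΩ_of_hecke F ι₁ Jstar K₀ S hU7ₛ hJ hJu w hw Kc Line quotΩ translΩ hhecke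
    (fun _ hg => UnitaryGroup.exists_mul_mk_eq_heckeElementAt_two_of_mem_orbit hKc
      (⟨w, rfl⟩ : UnitaryGroup.PlacesOver F (w.under (𝓞 ↥(maximalRealSubfield F)))) (IsCMField.complexConj_ne_one F) hJ hw
      (UnitaryGroup.isUnit_placeForm Jstar hJu w) hunit (HeckeCharacter.uniformizer F w) hg)
    y L

end Summit.HodgeConjecture.HodgeConjecture.Cruxes.HLiu418.F0P6cHeckeBacktrack

end
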